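import Mathlib

/-!
# Hodge-locus census, engine B (abs-2 gen 28): THEOREM QL — the finite "axis classification" in the
maximal order of the definite quaternion algebra `(−1,−3)_ℚ` (kernel-checked certificate).

certified instances and evidence bearing on the general Hodge conjecture; no claim.

Setting (T-0@3): `B = (−1,−3)_ℚ` with `i² = −1`, `j² = −3`, `k = ij`; the maximal order
`O = ℤ⟨1, i, (1+j)/2, (i+k)/2⟩` has the twelve units `±1, ±i, (±1 ± j)/2, (±i ± k)/2` and the twelve
elements of reduced norm 3 `±j, ±k, (±3 ± j)/2, (±3i ± k)/2` (= `φ·O^×`, `φ` a Frobenius element).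
For a pure quaternion `y = b·i + c·j + d·k` (an embedded `√D`) THEOREM QL needs exactly:
* some UNIT `u` conjugates `y` to `−y` (i.e. `u y = −y u`) iff `b = 0 ∨ b = 3d ∨ b = −3d`
  (the root `θ_y` lies in `U = ℚ₃(i)`), and
* some NORM-3 element `π` satisfies `π y = −y π` iff `c = 0 ∨ d = 0 ∨ b = d ∨ b = −d`
  (the root lies in `K′`).
Both are decided here by computing the twelve products in each case over `ℚ`.
-/

namespace Summit.HodgeConjecture.HodgeConjecture.HodgeLocus.Census.QL

/-- the quaternion algebra `(−1,−3)_ℚ` in Mathlib's three-parameter form (`i² = −1`, `j² = −3`, `ij = k`). -/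
abbrev B := QuaternionAlgebra ℚ (-1) 0 (-3)

/-- the pure quaternion `b i + c j + d k`. -/
def pureQ (b c d : ℚ) : B := ⟨0, b, c, d⟩

/-- the twelve units of the maximal order `ℤ⟨1, i, (1+j)/2, (i+k)/2⟩`. -/
def unitList : List B :=
  [⟨1, 0, 0, 0⟩, ⟨-1, 0, 0, 0⟩, ⟨0, 1, 0, 0⟩, ⟨0, -1, 0, 0⟩,
   ⟨1/2, 0, 1/2, 0⟩, ⟨1/2, 0, -1/2, 0⟩, ⟨-1/2, 0, 1/2, 0⟩, ⟨-1/2, 0, -1/2, 0⟩,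
   ⟨0, 1/2, 0, 1/2⟩, ⟨0, 1/2, 0, -1/2⟩, ⟨0, -1/2, 0, 1/2⟩, ⟨0, -1/2, 0, -1/2⟩]

/-- the twelve elements of reduced norm 3 of the maximal order. -/
def normThreeList : List B :=
  [⟨0, 0, 1, 0⟩, ⟨0, 0, -1, 0⟩, ⟨0, 0, 0, 1⟩, ⟨0, 0, 0, -1⟩,
   ⟨3/2, 0, 1/2, 0⟩, ⟨3/2, 0, -1/2, 0⟩, ⟨-3/2, 0, 1/2, 0⟩, ⟨-3/2, 0, -1/2, 0⟩,
   ⟨0, 3/2, 0, 1/2⟩, ⟨0, 3/2, 0, -1/2⟩, ⟨0, -3/2, 0, 1/2⟩, ⟨0, -3/2, 0, -1/2⟩]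

/-- U-criterion of THEOREM QL: a unit anti-commutes with `y = bi + cj + dk` iff `b ∈ {0, 3d, −3d}`. -/
theorem unit_anticommutes_iff (b c d : ℚ) :
    (∃ u ∈ unitList, u * pureQ b c d = -(pureQ b c d * u)) ↔ (b = 0 ∨ b = 3 * d ∨ b = -3 * d) := by
  constructor
  · rintro ⟨u, hu, h⟩
    simp only [unitList, List.mem_cons, List.mem_nil_iff, or_false] at hu
    rcases hu with rfl | rfl | rfl | rfl | rfl | rfl | rfl | rfl | rfl | rfl | rfl | rfl <;>
      simp [pureQ, QuaternionAlgebra.ext_iff] at h <;>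
      first
        | (left; linarith)
        | (right; left; linarith)
        | (right; right; linarith)
  · rintro (h | h | h)
    · exact ⟨⟨0, 1, 0, 0⟩, by simp [unitList], by
        subst h; ext <;> simp [pureQ]⟩
    · exact ⟨⟨0, 1/2, 0, -1/2⟩, by simp [unitList], by
        subst h; ext <;> simp [pureQ] <;> ring⟩
    · exact ⟨⟨0, 1/2, 0, 1/2⟩, by simp [unitList], by
        subst h; ext <;> simp [pureQ] <;> ring⟩

/-- K′-criterion of THEOREM QL: a norm-3 element anti-commutes with `y` iff `c = 0 ∨ d = 0 ∨ b = ±d`. -/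
theorem normThree_anticommutes_iff (b c d : ℚ) :
    (∃ u ∈ normThreeList, u * pureQ b c d = -(pureQ b c d * u)) ↔
      (c = 0 ∨ d = 0 ∨ b = d ∨ b = -d) := by
  constructor
  · rintro ⟨u, hu, h⟩
    simp only [normThreeList, List.mem_cons, List.mem_nil_iff, or_false] at hu
    rcases hu with rfl | rfl | rfl | rfl | rfl | rfl | rfl | rfl | rfl | rfl | rfl | rfl <;>
      simp [pureQ, QuaternionAlgebra.ext_iff] at h <;>
      first
        | (left; linarith)
        | (right; left; linarith)
        | (right; right; left; linarith)
        | (right; right; right; linarith)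
  · rintro (h | h | h | h)
    · exact ⟨⟨0, 0, 1, 0⟩, by simp [normThreeList], by
        subst h; ext <;> simp [pureQ]⟩
    · exact ⟨⟨0, 0, 0, 1⟩, by simp [normThreeList], by
        subst h; ext <;> simp [pureQ]⟩
    · exact ⟨⟨0, 3/2, 0, -1/2⟩, by simp [normThreeList], by
        subst h; ext <;> simp [pureQ] <;> ring⟩
    · exact ⟨⟨0, 3/2, 0, 1/2⟩, by simp [normThreeList], by
        subst h; ext <;> simp [pureQ] <;> ring⟩

end Summit.HodgeConjecture.HodgeConjecture.HodgeLocus.Census.QL
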